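import Summits.ValiantsHypothesis.ValiantsHypothesis.Theorems.BarrierLeverAnchoredDoorHitsLowerPairsSplitFamilySmall

/-!
# Support item `AnchoredDoorHitsLowerPairs` (stmt-ValiantsHypothesis-22510), line `anchored-peeling`:
# CONJECTURE SP for all `m` — part 3: THE DOOR DESIGN (codes), its degrees in the scale `L` and its leading (limit) design

Helper file (`--supports stmt-ValiantsHypothesis-22510`; cell valiant-natproofs, rung V4, 𝒟-side door (c); registered line
`Cruxes/AnchoredDoorHitsLowerPairs/Lines/anchored_peeling.lean` v24, registered stub `stub_splitFamilyGe3`; prover seat val-np-p1 gen 24;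
memo HOME/val-np-p1/g24/MEMO-SP-proof-valnp1-g24.md §3, §6 B2). Closes NO item.

COORDINATES (all by VALUE, as index sets in `ℕ`; the split pair at level `m`, `M = 2^m`): x-variables `a_i = i` (`i ≤ m`, `a* := a_m = m`), `α = m+1`,
`b_j = m+2+j` (`j < m`; `sh m t` is the set of `b_j`, `j ∈ t`); y-vertices: clique `v_P ↔ y = enc P` (`P ⊆ range (m+1)`, `y < 2M`; `ω = v_∅ = 0`),
independent `u_t ↔ y = 2M + enc t − 1` (`∅ ≠ t ⊆ range m`).

THE DESIGN `𝒟(L)` (memo §3), over any commutative ring `R` with a scale `L : R` (`thetaN`, `phiN` = root weights / tails by value):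
`ω = x_α`; `u_t = x_{b_{min t}} ∏_{j ∈ t ∖ min} (1 + L x_{b_j})`; `v_P = L^{[m∉P]} x_{min P} ∏_{a ∈ P∖min}(1 + L x_a) + c_P x_α (1 + [m∉P] x_m) ∏_{j ∈ P∖m}(1 + L x_{b_j})`
(`P ≠ {m}`), `v_{m} = x_m + x_α ∏_j (1 + x_{b_j})`, with `c_P = cw m P` (`= enc (P∖m) + 2` on big `P ∋ m`, `P ≠ {m}`; `= 1` otherwise).
* `doorFunN θ φ y C = Σ_{b∈C} θ_{by} ∏_{b'∈C∖b} φ_{byb'}` — the door coefficient function by value (it is `SplitGeneral.doorFun` read through `Fin.val`, see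
  the sequel); closed forms per vertex type (`doorFunN_clique`, `doorFunN_indep`, …).
* Over `ℂ[L]` (`L = X`): `natDegree ≤ dgN m y` (`natDegree_doorFunN_le`) and the TOP coefficient is the LIMIT DESIGN `vtopN m y C` (`coeff_doorFunN_top`):
  monomial personas `[C = P]`, `[C = sh t]`, and the α-parts `c_P([C = {α} ∪ sh s] + [m∉P][C = {m, α} ∪ sh s])` (`s = P ∖ m`), `v_{m} ↦ [C = {m}] + [α ∈ C ⊆ {α} ∪ sh(range m)]`.
* `map_thetaN`, `map_phiN`, `map_doorFunN`: ring maps act on the scale only (evaluation `L ↦ L₀`).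

WHAT THIS IS NOT: no determinant here; nothing on crux stmt-ValiantsHypothesis-14610 or on `VP` versus `VNP`.
-/

set_option linter.dupNamespace false

namespace Summit.ValiantsHypothesis.ValiantsHypothesis.Theorems.BarrierLever.AnchoredPeeling

namespace SplitGeneral

open Finset DecFamily

/-! ## 1. Value coordinates -/

/-- The `b`-variables of the index set `t`: `sh m t = {m + 2 + j : j ∈ t}`. -/
def sh (m : ℕ) (t : Finset ℕ) : Finset ℕ := t.map (addLeftEmbedding (m + 2))

/-- Membership in `sh`. -/
theorem mem_sh {m : ℕ} {t : Finset ℕ} {v : ℕ} : v ∈ sh m t ↔ m + 2 ≤ v ∧ v - (m + 2) ∈ t := by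
  rw [sh, Finset.mem_map]
  constructor
  · rintro ⟨j, hj, rfl⟩
    simp only [addLeftEmbedding_apply]
    exact ⟨Nat.le_add_right _ _, by rwa [Nat.add_sub_cancel_left]⟩
  · rintro ⟨hle, hmem⟩
    exact ⟨v - (m + 2), hmem, by simp only [addLeftEmbedding_apply]; omega⟩

/-- `sh` is injective. -/
theorem sh_injective (m : ℕ) : Function.Injective (sh m) := fun _ _ htt =>
  Finset.map_injective (addLeftEmbedding (m + 2)) htt

/-- `card (sh m t) = card t`. -/
theorem card_sh (m : ℕ) (t : Finset ℕ) : (sh m t).card = t.card := Finset.card_map _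

/-- `sh` is monotone and reflects inclusion. -/
theorem sh_subset_sh_iff {m : ℕ} (t t' : Finset ℕ) : sh m t ⊆ sh m t' ↔ t ⊆ t' := by rw [sh, sh, Finset.map_subset_map]

/-- Elements of `sh m t` are `≥ m + 2`. -/
theorem le_of_mem_sh {m : ℕ} {t : Finset ℕ} {v : ℕ} (hv : v ∈ sh m t) : m + 2 ≤ v := (mem_sh.mp hv).1

/-- The weight `c_P` of the `α`-root of the clique vertex `P`. -/
def cw (m : ℕ) (P : Finset ℕ) : ℕ := if m ∈ P ∧ P ≠ {m} then enc (P.erase m) + 2 else 1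

/-- `c_P ≠ 0` (as a natural number it is `≥ 1`). -/
theorem one_le_cw (m : ℕ) (P : Finset ℕ) : 1 ≤ cw m P := by
  unfold cw; split_ifs <;> omega

/-! ## 2. The design (root weights and tails by value) -/

section Design

variable {R : Type*} [CommRing R]

/-- The tail set allowed for the `α`-root of the clique vertex `P ≠ {m}`: `{m}` if `m ∉ P` (the foreign variable `a* = a_m`), and `sh m (P ∖ m)`. -/
def alphaTail (m : ℕ) (P : Finset ℕ) : Finset ℕ := (if m ∈ P then ∅ else {m}) ∪ sh m (P.erase m)

/-- **Root weights `θ` of the design `𝒟(L)`** (by value; `y` = vertex value, `b` = x-variable value). -/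
def thetaN (m : ℕ) (L : R) (b y : ℕ) : R :=
  if y < 2 ^ (m + 1) then
    (if hP : (bits y).Nonempty then
      (if b = (bits y).min' hP then (if m ∈ bits y then 1 else L)
       else if b = m + 1 then (cw m (bits y) : R) else 0)
     else (if b = m + 1 then 1 else 0))
  else if y + 1 < 2 ^ (m + 1) + 2 ^ m then
    (if ht : (bits (y + 1 - 2 ^ (m + 1))).Nonempty then
      (if b = m + 2 + (bits (y + 1 - 2 ^ (m + 1))).min' ht then 1 else 0)
     else 0)
  else 0

/-- **Tails `φ` of the design `𝒟(L)`** (by value). -/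
def phiN (m : ℕ) (L : R) (b y b' : ℕ) : R :=
  if y < 2 ^ (m + 1) then
    (if hP : (bits y).Nonempty then
      (if b = (bits y).min' hP then (if b' ∈ bits y ∧ b' ≠ (bits y).min' hP then L else 0)
       else if b = m + 1 then
         (if bits y = {m} then (if b' ∈ sh m (range m) then 1 else 0)
          else (if b' ∈ alphaTail m (bits y) then (if b' = m then 1 else L) else 0))
       else 0)
     else 0)
  else if y + 1 < 2 ^ (m + 1) + 2 ^ m then
    (if ht : (bits (y + 1 - 2 ^ (m + 1))).Nonempty then
      (if b = m + 2 + (bits (y + 1 - 2 ^ (m + 1))).min' ht then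
        (if b' ∈ sh m (bits (y + 1 - 2 ^ (m + 1))) ∧ b' ≠ m + 2 + (bits (y + 1 - 2 ^ (m + 1))).min' ht then L else 0)
       else 0)
     else 0)
  else 0

/-- The door coefficient function by value: `Σ_{b ∈ C} θ_{by} ∏_{b' ∈ C ∖ b} φ_{byb'}`. -/
def doorFunN (θ : ℕ → ℕ → R) (φ : ℕ → ℕ → ℕ → R) (y : ℕ) (C : Finset ℕ) : R :=
  ∑ b ∈ C, θ b y * ∏ b' ∈ C.erase b, φ b y b'

/-- A ring map acts on the design through the scale: `ψ (θ_L) = θ_{ψ L}`. -/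
theorem map_thetaN {S : Type*} [CommRing S] (ψ : R →+* S) (m : ℕ) (L : R) (b y : ℕ) :
    ψ (thetaN m L b y) = thetaN m (ψ L) b y := by
  unfold thetaN
  split_ifs <;> simp

/-- A ring map acts on the tails through the scale. -/
theorem map_phiN {S : Type*} [CommRing S] (ψ : R →+* S) (m : ℕ) (L : R) (b y b' : ℕ) :
    ψ (phiN m L b y b') = phiN m (ψ L) b y b' := by
  unfold phiN
  split_ifs <;> simp

/-- A ring map acts on door coefficient functions parameterwise. -/
theorem map_doorFunN {S : Type*} [CommRing S] (ψ : R →+* S) (θ : ℕ → ℕ → R) (φ : ℕ → ℕ → ℕ → R) (y : ℕ) (C : Finset ℕ) :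
    ψ (doorFunN θ φ y C) = doorFunN (fun b y => ψ (θ b y)) (fun b y b' => ψ (φ b y b')) y C := by
  unfold doorFunN; rw [map_sum]; exact Finset.sum_congr rfl (fun b _ => by rw [map_mul, map_prod])

/-- Evaluation of the design at `L ↦ L₀`. -/
theorem map_doorFunN_design {S : Type*} [CommRing S] (ψ : R →+* S) (m : ℕ) (L : R) (y : ℕ) (C : Finset ℕ) :
    ψ (doorFunN (thetaN m L) (phiN m L) y C) = doorFunN (thetaN m (ψ L)) (phiN m (ψ L)) y C := by
  rw [map_doorFunN]
  unfold doorFunN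
  refine Finset.sum_congr rfl (fun b _ => ?_)
  simp only [map_thetaN, map_phiN]

/-! ## 3. Closed forms of the door coefficient functions -/

/-- A sum supported on at most two points. -/
theorem sum_two_points (C : Finset ℕ) (f : ℕ → R) (v₁ v₂ : ℕ) (hne : v₁ ≠ v₂)
    (hf : ∀ b ∈ C, b ≠ v₁ → b ≠ v₂ → f b = 0) :
    ∑ b ∈ C, f b = (if v₁ ∈ C then f v₁ else 0) + (if v₂ ∈ C then f v₂ else 0) := by
  classical
  have hsplit : ∑ b ∈ C, f b = ∑ b ∈ C.filter (fun b => b = v₁ ∨ b = v₂), f b := by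
    rw [Finset.sum_filter]
    refine Finset.sum_congr rfl (fun b hb => ?_)
    by_cases h12 : b = v₁ ∨ b = v₂
    · rw [if_pos h12]
    · push Not at h12; rw [if_neg (by tauto), hf b hb h12.1 h12.2]
  rw [hsplit]
  by_cases h1 : v₁ ∈ C <;> by_cases h2 : v₂ ∈ C
  · have : C.filter (fun b => b = v₁ ∨ b = v₂) = {v₁, v₂} := by
      ext b; simp only [Finset.mem_filter, Finset.mem_insert, Finset.mem_singleton]
      constructor
      · rintro ⟨_, h⟩; exact h
      · rintro (rfl | rfl); exacts [⟨h1, Or.inl rfl⟩, ⟨h2, Or.inr rfl⟩]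
    rw [this, Finset.sum_pair hne, if_pos h1, if_pos h2]
  · have : C.filter (fun b => b = v₁ ∨ b = v₂) = {v₁} := by
      ext b; simp only [Finset.mem_filter, Finset.mem_singleton]
      constructor
      · rintro ⟨hb, rfl | rfl⟩; exacts [rfl, absurd hb h2]
      · rintro rfl; exact ⟨h1, Or.inl rfl⟩
    rw [this, Finset.sum_singleton, if_pos h1, if_neg h2, add_zero]
  · have : C.filter (fun b => b = v₁ ∨ b = v₂) = {v₂} := by
      ext b; simp only [Finset.mem_filter, Finset.mem_singleton]
      constructor
      · rintro ⟨hb, rfl | rfl⟩; exacts [absurd hb h1, rfl]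
      · rintro rfl; exact ⟨h2, Or.inr rfl⟩
    rw [this, Finset.sum_singleton, if_neg h1, if_pos h2, zero_add]
  · have : C.filter (fun b => b = v₁ ∨ b = v₂) = ∅ := by
      ext b; simp only [Finset.mem_filter, Finset.notMem_empty, iff_false, not_and]
      rintro hb (rfl | rfl); exacts [h1 hb, h2 hb]
    rw [this, Finset.sum_empty, if_neg h1, if_neg h2, add_zero]

/-- A sum supported on at most one point. -/
theorem sum_one_point (C : Finset ℕ) (f : ℕ → R) (v₁ : ℕ) (hf : ∀ b ∈ C, b ≠ v₁ → f b = 0) :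
    ∑ b ∈ C, f b = if v₁ ∈ C then f v₁ else 0 := by
  classical
  rw [← Finset.sum_filter_add_sum_filter_not C (fun b => b = v₁)]
  have hz : ∑ b ∈ C.filter (fun b => ¬ b = v₁), f b = 0 :=
    Finset.sum_eq_zero (fun b hb => hf b (Finset.mem_filter.mp hb).1 (Finset.mem_filter.mp hb).2)
  rw [hz, add_zero]
  by_cases h1 : v₁ ∈ C
  · have : C.filter (fun b => b = v₁) = {v₁} := by
      ext b; simp only [Finset.mem_filter, Finset.mem_singleton]
      constructor
      · rintro ⟨_, rfl⟩; rfl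
      · rintro rfl; exact ⟨h1, rfl⟩
    rw [this, Finset.sum_singleton, if_pos h1]
  · have : C.filter (fun b => b = v₁) = ∅ := by
      ext b; simp only [Finset.mem_filter, Finset.notMem_empty, iff_false, not_and]
      rintro hb rfl; exact h1 hb
    rw [this, Finset.sum_empty, if_neg h1]

/-- A product of `[p b] · L` over `D` is `[∀ b ∈ D, p b] · L^{|D|}`. -/
theorem prod_ite_const_zero (D : Finset ℕ) (p : ℕ → Prop) [DecidablePred p] (L : R) :
    ∏ b ∈ D, (if p b then L else 0) = if (∀ b ∈ D, p b) then L ^ D.card else 0 := by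
  rw [Finset.prod_ite_zero, Finset.prod_const]

/-- **Closed form, clique vertex `P ≠ ∅`, `P ≠ {m}`:** persona part + `α` part. -/
theorem doorFunN_clique (m : ℕ) (L : R) {y : ℕ} (hy : y < 2 ^ (m + 1)) (hP : (bits y).Nonempty) (hPm : bits y ≠ {m}) (C : Finset ℕ) :
    doorFunN (thetaN m L) (phiN m L) y C =
      (if (bits y).min' hP ∈ C ∧ C.erase ((bits y).min' hP) ⊆ (bits y).erase ((bits y).min' hP)
        then (if m ∈ bits y then 1 else L) * L ^ (C.card - 1) else 0) +
      (if m + 1 ∈ C ∧ C.erase (m + 1) ⊆ alphaTail m (bits y)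
        then (cw m (bits y) : R) * L ^ ((C.erase (m + 1)).filter (fun b => b ≠ m)).card else 0) := by
  classical
  set P := bits y with hPdef
  set p₀ := P.min' hP with hp₀
  have hp₀P : p₀ ∈ P := Finset.min'_mem P hP
  have hp₀le : p₀ ≤ m := by
    have := bits_subset_range hy hp₀P
    exact Nat.lt_succ_iff.mp (Finset.mem_range.mp this)
  have hne : p₀ ≠ m + 1 := by omega
  -- θ vanishes off the two roots
  have hθ : ∀ b, thetaN m L b y = if b = p₀ then (if m ∈ P then 1 else L) else if b = m + 1 then (cw m P : R) else 0 := by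
    intro b; unfold thetaN; rw [if_pos hy, dif_pos hP]
  have hφroot : ∀ b', phiN m L p₀ y b' = if b' ∈ P ∧ b' ≠ p₀ then L else 0 := by
    intro b'; unfold phiN; rw [if_pos hy, dif_pos hP, if_pos rfl]
  have hφal : ∀ b', phiN m L (m + 1) y b' = if b' ∈ alphaTail m P then (if b' = m then 1 else L) else 0 := by
    intro b'; unfold phiN; rw [if_pos hy, dif_pos hP, if_neg (Ne.symm hne), if_pos rfl, if_neg hPm]
  unfold doorFunN
  rw [sum_two_points C _ p₀ (m + 1) hne (fun b _ hb1 hb2 => by rw [hθ, if_neg hb1, if_neg hb2, zero_mul])]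
  congr 1
  · -- persona part
    rw [hθ, if_pos rfl]
    have hprod : ∏ b' ∈ C.erase p₀, phiN m L p₀ y b' = if (∀ b' ∈ C.erase p₀, b' ∈ P ∧ b' ≠ p₀) then L ^ (C.erase p₀).card else 0 := by
      rw [← prod_ite_const_zero]; exact Finset.prod_congr rfl (fun b' _ => hφroot b')
    rw [hprod]
    have hiff : (∀ b' ∈ C.erase p₀, b' ∈ P ∧ b' ≠ p₀) ↔ C.erase p₀ ⊆ P.erase p₀ :=
      ⟨fun hall b' hb' => Finset.mem_erase.mpr ⟨(hall b' hb').2, (hall b' hb').1⟩,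
       fun hsub b' hb' => ⟨Finset.mem_of_mem_erase (hsub hb'), (Finset.mem_erase.mp (hsub hb')).1⟩⟩
    by_cases h0 : p₀ ∈ C
    · rw [if_pos h0, Finset.card_erase_of_mem h0]
      by_cases hsub : C.erase p₀ ⊆ P.erase p₀
      · rw [if_pos (hiff.mpr hsub), if_pos (show p₀ ∈ C ∧ C.erase p₀ ⊆ P.erase p₀ from ⟨h0, hsub⟩)]
      · rw [if_neg (fun hall => hsub (hiff.mp hall)), if_neg (show ¬ (p₀ ∈ C ∧ C.erase p₀ ⊆ P.erase p₀) from fun h => hsub h.2), mul_zero]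
    · rw [if_neg h0, if_neg (show ¬ (p₀ ∈ C ∧ C.erase p₀ ⊆ P.erase p₀) from fun h => h0 h.1)]
  · -- α part
    rw [hθ, if_neg (Ne.symm hne), if_pos rfl]
    have hprod : ∏ b' ∈ C.erase (m + 1), phiN m L (m + 1) y b' =
        if (∀ b' ∈ C.erase (m + 1), b' ∈ alphaTail m P) then ∏ b' ∈ C.erase (m + 1), (if b' = m then (1 : R) else L) else 0 := by
      rw [← Finset.prod_ite_zero]; exact Finset.prod_congr rfl (fun b' _ => hφal b')
    rw [hprod]
    by_cases h1 : m + 1 ∈ C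
    · rw [if_pos h1]
      by_cases hsub : C.erase (m + 1) ⊆ alphaTail m P
      · rw [if_pos (show ∀ b' ∈ C.erase (m + 1), b' ∈ alphaTail m P from fun b' hb' => hsub hb'),
          if_pos (show m + 1 ∈ C ∧ C.erase (m + 1) ⊆ alphaTail m P from ⟨h1, hsub⟩)]
        congr 1
        rw [Finset.prod_ite, Finset.prod_const_one, one_mul, Finset.prod_const]
      · rw [if_neg (show ¬ ∀ b' ∈ C.erase (m + 1), b' ∈ alphaTail m P from fun hall => hsub hall),
          if_neg (show ¬ (m + 1 ∈ C ∧ C.erase (m + 1) ⊆ alphaTail m P) from fun h => hsub h.2), mul_zero]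
    · rw [if_neg h1, if_neg (show ¬ (m + 1 ∈ C ∧ C.erase (m + 1) ⊆ alphaTail m P) from fun h => h1 h.1)]

/-- **Closed form, the vertex `v_{m}` (`P = {m}`).** -/
theorem doorFunN_top (m : ℕ) (L : R) {y : ℕ} (hy : y < 2 ^ (m + 1)) (hPm : bits y = {m}) (C : Finset ℕ) :
    doorFunN (thetaN m L) (phiN m L) y C =
      (if C = {m} then 1 else 0) + (if m + 1 ∈ C ∧ C.erase (m + 1) ⊆ sh m (range m) then 1 else 0) := by
  classical
  have hP : (bits y).Nonempty := by rw [hPm]; exact Finset.singleton_nonempty m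
  have hmP : m ∈ bits y := by rw [hPm]; exact Finset.mem_singleton_self m
  have hmin : (bits y).min' hP = m := by
    have h1 : (bits y).min' hP ≤ m := Finset.min'_le _ _ hmP
    have h2 : m ≤ (bits y).min' hP := Finset.le_min' _ _ _ (fun b hb => by
      have hb' : b ∈ ({m} : Finset ℕ) := hPm ▸ hb
      rw [Finset.mem_singleton.mp hb'])
    omega
  have hne : m ≠ m + 1 := by omega
  have hθ : ∀ b, thetaN m L b y = if b = m then 1 else if b = m + 1 then (cw m (bits y) : R) else 0 := by
    intro b; unfold thetaN; rw [if_pos hy, dif_pos hP, hmin, if_pos hmP]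
  have hcw : cw m (bits y) = 1 := by unfold cw; rw [if_neg (fun h => h.2 hPm)]
  have hφroot : ∀ b', phiN m L m y b' = 0 := by
    intro b'; unfold phiN; rw [if_pos hy, dif_pos hP, hmin, if_pos rfl, if_neg]
    rw [hPm]; rintro ⟨hb, hbne⟩; exact hbne (Finset.mem_singleton.mp hb)
  have hφal : ∀ b', phiN m L (m + 1) y b' = if b' ∈ sh m (range m) then 1 else 0 := by
    intro b'; unfold phiN; rw [if_pos hy, dif_pos hP, hmin, if_neg (Ne.symm hne), if_pos rfl, if_pos hPm]
  unfold doorFunN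
  rw [sum_two_points C _ m (m + 1) hne (fun b _ hb1 hb2 => by rw [hθ, if_neg hb1, if_neg hb2, zero_mul])]
  congr 1
  · rw [hθ, if_pos rfl, one_mul]
    by_cases h0 : m ∈ C
    · rw [if_pos h0]
      by_cases hC : C = {m}
      · rw [if_pos hC, hC, Finset.erase_singleton, Finset.prod_empty]
      · rw [if_neg hC]
        obtain ⟨b', hb'C, hb'm⟩ : ∃ b' ∈ C, b' ≠ m := by
          by_contra hall; push Not at hall
          exact hC (Finset.eq_singleton_iff_unique_mem.mpr ⟨h0, hall⟩)
        exact Finset.prod_eq_zero (Finset.mem_erase.mpr ⟨hb'm, hb'C⟩) (hφroot b')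
    · rw [if_neg h0, if_neg (show ¬ C = {m} from fun hC => h0 (by rw [hC]; exact Finset.mem_singleton_self m))]
  · rw [hθ, if_neg (Ne.symm hne), if_pos rfl, hcw, Nat.cast_one, one_mul]
    have hprod : ∏ b' ∈ C.erase (m + 1), phiN m L (m + 1) y b' = if (∀ b' ∈ C.erase (m + 1), b' ∈ sh m (range m)) then (1 : R) ^ (C.erase (m + 1)).card else 0 := by
      rw [← prod_ite_const_zero]; exact Finset.prod_congr rfl (fun b' _ => hφal b')
    rw [hprod, one_pow]
    by_cases h1 : m + 1 ∈ C
    · rw [if_pos h1]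
      by_cases hsub : C.erase (m + 1) ⊆ sh m (range m)
      · rw [if_pos (show ∀ b' ∈ C.erase (m + 1), b' ∈ sh m (range m) from fun b' hb' => hsub hb'),
          if_pos (show m + 1 ∈ C ∧ C.erase (m + 1) ⊆ sh m (range m) from ⟨h1, hsub⟩)]
      · rw [if_neg (show ¬ ∀ b' ∈ C.erase (m + 1), b' ∈ sh m (range m) from fun hall => hsub hall),
          if_neg (show ¬ (m + 1 ∈ C ∧ C.erase (m + 1) ⊆ sh m (range m)) from fun h => hsub h.2)]
    · rw [if_neg h1, if_neg (show ¬ (m + 1 ∈ C ∧ C.erase (m + 1) ⊆ sh m (range m)) from fun h => h1 h.1)]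

/-- **Closed form, `ω` (`y = 0`).** -/
theorem doorFunN_omega (m : ℕ) (L : R) (C : Finset ℕ) :
    doorFunN (thetaN m L) (phiN m L) 0 C = if C = {m + 1} then 1 else 0 := by
  classical
  have hy : 0 < 2 ^ (m + 1) := Nat.pos_of_ne_zero (by positivity)
  have hP : ¬ (bits 0).Nonempty := by rw [bits_eq_empty_iff.mpr rfl]; exact Finset.not_nonempty_empty
  have hθ : ∀ b, thetaN m L b 0 = if b = m + 1 then 1 else 0 := by
    intro b; unfold thetaN; rw [if_pos hy, dif_neg hP]
  have hφ : ∀ b b', phiN m L b 0 b' = 0 := by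
    intro b b'; unfold phiN; rw [if_pos hy, dif_neg hP]
  unfold doorFunN
  rw [sum_one_point C _ (m + 1) (fun b _ hb => by rw [hθ, if_neg hb, zero_mul])]
  by_cases h1 : m + 1 ∈ C
  · rw [if_pos h1, hθ, if_pos rfl, one_mul]
    by_cases hC : C = {m + 1}
    · rw [if_pos hC, hC, Finset.erase_singleton, Finset.prod_empty]
    · rw [if_neg hC]
      obtain ⟨b', hb'C, hb'm⟩ : ∃ b' ∈ C, b' ≠ m + 1 := by
        by_contra hall; push Not at hall
        exact hC (Finset.eq_singleton_iff_unique_mem.mpr ⟨h1, hall⟩)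
      exact Finset.prod_eq_zero (Finset.mem_erase.mpr ⟨hb'm, hb'C⟩) (hφ _ b')
  · rw [if_neg h1, if_neg (show ¬ C = {m + 1} from fun hC => h1 (by rw [hC]; exact Finset.mem_singleton_self _))]

/-- **Closed form, independent vertex `u_t`** (`t = bits (y + 1 − 2M) ≠ ∅`). -/
theorem doorFunN_indep (m : ℕ) (L : R) {y : ℕ} (hy : ¬ y < 2 ^ (m + 1)) (hy' : y + 1 < 2 ^ (m + 1) + 2 ^ m)
    (ht : (bits (y + 1 - 2 ^ (m + 1))).Nonempty) (C : Finset ℕ) :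
    doorFunN (thetaN m L) (phiN m L) y C =
      if m + 2 + (bits (y + 1 - 2 ^ (m + 1))).min' ht ∈ C ∧ C ⊆ sh m (bits (y + 1 - 2 ^ (m + 1))) then L ^ (C.card - 1) else 0 := by
  classical
  set t := bits (y + 1 - 2 ^ (m + 1)) with htdef
  set r₀ := m + 2 + t.min' ht with hr₀
  have hθ : ∀ b, thetaN m L b y = if b = r₀ then 1 else 0 := by
    intro b; unfold thetaN; rw [if_neg hy, if_pos hy', dif_pos ht]
  have hφ : ∀ b', phiN m L r₀ y b' = if b' ∈ sh m t ∧ b' ≠ r₀ then L else 0 := by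
    intro b'; unfold phiN; rw [if_neg hy, if_pos hy', dif_pos ht, if_pos rfl]
  unfold doorFunN
  rw [sum_one_point C _ r₀ (fun b _ hb => by rw [hθ, if_neg hb, zero_mul])]
  have hr₀t : r₀ ∈ sh m t := mem_sh.mpr ⟨by omega, by
    have : r₀ - (m + 2) = t.min' ht := by omega
    rw [this]; exact Finset.min'_mem t ht⟩
  by_cases h0 : r₀ ∈ C
  · rw [if_pos h0, hθ, if_pos rfl, one_mul]
    have hprod : ∏ b' ∈ C.erase r₀, phiN m L r₀ y b' = if (∀ b' ∈ C.erase r₀, b' ∈ sh m t ∧ b' ≠ r₀) then L ^ (C.erase r₀).card else 0 := by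
      rw [← prod_ite_const_zero]; exact Finset.prod_congr rfl (fun b' _ => hφ b')
    rw [hprod, Finset.card_erase_of_mem h0]
    by_cases hsub : C ⊆ sh m t
    · rw [if_pos (show ∀ b' ∈ C.erase r₀, b' ∈ sh m t ∧ b' ≠ r₀ from fun b' hb' => ⟨hsub (Finset.mem_of_mem_erase hb'), (Finset.mem_erase.mp hb').1⟩),
        if_pos (show r₀ ∈ C ∧ C ⊆ sh m t from ⟨h0, hsub⟩)]
    · rw [if_neg, if_neg (show ¬ (r₀ ∈ C ∧ C ⊆ sh m t) from fun h => hsub h.2)]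
      intro hall
      apply hsub
      intro b' hb'
      by_cases hb : b' = r₀
      · rw [hb]; exact hr₀t
      · exact (hall b' (Finset.mem_erase.mpr ⟨hb, hb'⟩)).1
  · rw [if_neg h0, if_neg (show ¬ (r₀ ∈ C ∧ C ⊆ sh m t) from fun h => h0 h.1)]

/-- Vertices beyond the split graph have the zero door. -/
theorem doorFunN_none (m : ℕ) (L : R) {y : ℕ} (hy : ¬ y < 2 ^ (m + 1)) (hy' : ¬ y + 1 < 2 ^ (m + 1) + 2 ^ m) (C : Finset ℕ) :
    doorFunN (thetaN m L) (phiN m L) y C = 0 := by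
  unfold doorFunN
  refine Finset.sum_eq_zero (fun b _ => ?_)
  have : thetaN m L b y = 0 := by unfold thetaN; rw [if_neg hy, if_neg hy']
  rw [this, zero_mul]

end Design

end SplitGeneral

end Summit.ValiantsHypothesis.ValiantsHypothesis.Theorems.BarrierLever.AnchoredPeeling
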